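import Literature.Analysis.FluidPDE.QuasiSelfSimilarSymmetry
import HarnessLib

/-!
# Compatible block systems from two generating channels (Alberti–Crippa–Mazzucato 2019, §6.5,
§8.1 (e), §8.6; Bruè–De Lellis 2023, §4.1)

Topic `Literature/Analysis/FluidPDE`. The named fact `acm_compatible_blocks`
(`QuasiSelfSimilarCompatibleBlocks.lean`) asks for a whole *compatible block system*
(`QuasiSelfSimilar.IsCompatibleBlockSystem`): finitely many blocks with their gates, a child map,
a seed and universal gate fields, subject to analytic clauses (smoothness, incompressibility,
tangency, transport, normalisation, self-similarity, boundary structure) and to combinatorial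
clauses (gates of adjacent children match, gates on the parent's boundary sit at the middle of
the parent's gates, the seed squares match and have no outer gate).

In the source all blocks are obtained from **two generating channels** — the straight channel
`Γ₁` (crossing the two vertical sides of `Q` at their midpoints) and the bent channel `Γ₂`
(crossing the left and the bottom side) — moved around by the symmetries of the square
(ACM 2019, §6.5: "the two rotations of the straight channel and the four rotations of the bent
channel", `N = 6`; §8.1 (e): "translated, rescaled, and possibly rotated copy"; BDL 2023, §4.1),
the initial configuration being four rotated bent channels on `𝒬(2)` (ACM §6.5, Fig. 6), and the
smoothness across interfaces coming from one canonical field near every crossed side (ACM §8.6).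

This file performs that reduction once and for all, on top of the bookkeeping of
`QuasiSelfSimilarSymmetry.lean`:

* `QuasiSelfSimilar.Gen` — the two generators `S` (straight) and `B` (bent) with their gates
  `genGate` (`S`: the faces `{z₀ = 0}`, `{z₀ = 1}`; `B`: the faces `{z₀ = 0}`, `{z₁ = 0}`);
* `QuasiSelfSimilar.SymmCode` — a decidable code (swap of the axes, flip per axis) of the eight
  symmetries of the square, with `toSymm : SymmCode → SquareSymm` and a composition `mul`
  compatible with `SquareSymm.mul`;
* `QuasiSelfSimilar.IsGeneratorBlock` — the analytic clauses of `IsCompatibleBlockSystem` for a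
  single block; `QuasiSelfSimilar.IsEquivariantGateField` — invariance of the universal gate
  fields under the symmetries (the form produced by `SquareSymm.eq_gate_act`);
  `QuasiSelfSimilar.IsSnakeTable` — the three combinatorial clauses for a *snake table*
  `(childGen, childSym) : Gen → (Fin 2 → Fin 5) → Gen × SymmCode` (type and position of the
  child in each of the `25` subsquares of each generator, ACM §8.1 (e)), all decidable;
* `IsEquivariantGateField.of_parity` — equivariance from parity: it suffices that the axis-`0`
  gate velocity has odd normal / odd transversal component under the flip of the normal /
  transversal coordinate, that the axis-`0` gate scalar is even in both coordinates, and that the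
  axis-`1` fields are the swap-conjugates of the axis-`0` ones (the parities of the canonical
  field of a straight channel through the midpoint of a side);
* `acm_compatible_blocks_of_generators` — two generator blocks, equivariant gate fields, a snake
  table and generator-level self-similarity (`Θ_g(1, z) = (σ • Θ_{g'})(0, 5z - p)` on the
  subsquare `p`, with `(g', σ)` read off the table) give `acm_compatible_blocks`: the system has
  the `16` blocks `(g, c) ∈ Gen × SymmCode` (duplicates are harmless), block `(g, c)` being
  `c • (V_g, Θ_g)` with gates, children and seed transported along `c`
  (`blockGate`, `blockChild`, `seedBlock`);
* `peanoChildGen`, `peanoChildSym`, `isSnakeTable_peano` — one admissible snake table (a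
  Hamiltonian arrangement of the `25` children for each generator, the straight one invariant
  under the rotation by `π`), checked by `decide`: the combinatorial hypotheses are satisfiable
  and decidable as stated.

What is NOT done here is the geometry of the two generating moves (ACM §8.4–8.5, §8.9–8.11):
after this file, `acm_compatible_blocks` — hence `acm_building_blocks`, the family of BDL
Thm. 4.1 and everything proved from it — follows from two smooth incompressible moves of a
straight and of a bent channel in the unit square with the single-block clauses, one equivariant
gate field, and a snake table checked by `decide`.

## References

* G. Alberti, G. Crippa, A. L. Mazzucato, *Exponential self-similar mixing by incompressible
  flows*, J. Amer. Math. Soc. 32 (2019), 445–490: §6.5 (Fig. 6, `N = 6`), §8.1 (a)–(e),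
  §8.4 (a)–(c), §8.6 (arXiv:1605.02090, pp. 20–27).
* E. Bruè, C. De Lellis, *Anomalous dissipation for the forced 3D Navier–Stokes equations*,
  Comm. Math. Phys. 400 (2023), 1507–1533, §4.1 (i)–(iv) (`N = 6`).
-/

noncomputable section

open MeasureTheory Set Filter Function

open scoped ContDiff

namespace Literature.Analysis.FluidPDE

namespace QuasiSelfSimilar

open FunctionSpaces FunctionSpaces.Torus

/-! ## The two generators -/

/-- **The two generating channels** (ACM 2019, §6.5; §8.1: the curves `Γ₁`, `Γ₂`): `S`, the
straight channel (joining the midpoints of two opposite sides), and `B`, the bent channel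
(joining the midpoints of two adjacent sides). [cite: AlbertiCrippaMazzucato2019, §8.1] -/
inductive Gen
  /-- the straight channel `Γ₁` (here: left side to right side) -/
  | S
  /-- the bent channel `Γ₂` (here: left side to bottom side) -/
  | B
  deriving DecidableEq, Repr

/-- `Gen` is a finite type (two elements). [folklore] -/
instance : Fintype Gen where
  elems := {Gen.S, Gen.B}
  complete := fun g => by cases g <;> simp

/-- **The gates of the generators**, as a Boolean table indexed by the axis `k` and the side `s`
of the face `{z_k = faceValue s}`: `S` crosses the two opposite faces `{z₀ = 0}`, `{z₀ = 1}`,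
`B` the two adjacent faces `{z₀ = 0}`, `{z₁ = 0}` (ACM 2019, §8.1 (a), up to a symmetry of the
square: there `Q` is centred at the origin, `Γ₁(t)` joins the midpoints `(0, ∓1/2)` of two
opposite sides and `Γ₂(t)` the midpoints `(0, -1/2)`, `(1/2, 0)` of two adjacent sides). [cite: AlbertiCrippaMazzucato2019, §8.1 (a)] -/
def genGate : Gen → Fin 2 → Bool → Bool
  | .S, k, _ => decide (k = 0)
  | .B, _, s => !s

/-- The straight channel crosses exactly the two vertical faces. [folklore] -/
@[simp] theorem genGate_S (k : Fin 2) (s : Bool) : genGate .S k s = decide (k = 0) := rfl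

/-- The bent channel crosses exactly the two lower faces `{z₀ = 0}`, `{z₁ = 0}`. [folklore] -/
@[simp] theorem genGate_B (k : Fin 2) (s : Bool) : genGate .B k s = !s := rfl

/-! ## Codes of the symmetries of the square -/

/-- **A code of a symmetry of the square**: whether the two axes are swapped, and the flip of
each axis (the data of a `SquareSymm` with the permutation stored as a Boolean, so that tables of
codes are decidable). [folklore] -/
structure SymmCode where
  /-- swap the two axes? -/
  swap : Bool
  /-- flip the axis `k` (`z ↦ 1 - z`)? -/
  flip : Fin 2 → Bool
  deriving DecidableEq

namespace SymmCode

/-- Extensionality for codes. [folklore] -/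
@[ext] theorem ext {c c' : SymmCode} (h₁ : c.swap = c'.swap) (h₂ : c.flip = c'.flip) : c = c' := by
  cases c; cases c'; simp_all

/-- Codes are the image of `Bool × (Fin 2 → Bool)`. [folklore] -/
def equivProd : SymmCode ≃ Bool × (Fin 2 → Bool) where
  toFun c := (c.swap, c.flip)
  invFun p := ⟨p.1, p.2⟩
  left_inv c := by cases c; rfl
  right_inv p := by cases p; rfl

/-- `SymmCode` is a finite type (eight codes, one for each symmetry of the square). [folklore] -/
instance : Fintype SymmCode := Fintype.ofEquiv _ equivProd.symm

variable (c : SymmCode)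

/-- The permutation of the axes encoded by `swap`. [folklore] -/
def perm : Equiv.Perm (Fin 2) := if c.swap then Equiv.swap 0 1 else Equiv.refl _

/-- **The symmetry of the square encoded by `c`.** [folklore] -/
def toSymm : SquareSymm := ⟨c.perm, c.flip⟩

/-- The permutation of the encoded symmetry. [folklore] -/
@[simp] theorem toSymm_perm : c.toSymm.perm = c.perm := rfl

/-- The flips of the encoded symmetry. [folklore] -/
@[simp] theorem toSymm_flip : c.toSymm.flip = c.flip := rfl

/-- **Composition of codes**, matching `SquareSymm.mul`: swaps compose by `xor`, and the flip of
the axis `k` of the composite is the flip of `k` followed by the flip of the permuted axis. [folklore] -/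
def mul (c c' : SymmCode) : SymmCode :=
  ⟨xor c.swap c'.swap, fun k => xor (c.flip k) (c'.flip (c.perm k))⟩

/-- The flips of a composite. [folklore] -/
@[simp] theorem flip_mul (c' : SymmCode) (k : Fin 2) :
    (c.mul c').flip k = xor (c.flip k) (c'.flip (c.perm k)) := rfl

/-- The permutation of a composite is the composite permutation. [folklore] -/
theorem perm_mul (c' : SymmCode) : (c.mul c').perm = c.perm.trans c'.perm := by
  obtain ⟨s, f⟩ := c
  obtain ⟨s', f'⟩ := c'
  cases s <;> cases s' <;>
    first
    | rfl
    | (simp only [mul, perm]; ext i; fin_cases i <;> rfl)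

/-- The permutation of a composite, applied. [folklore] -/
@[simp] theorem perm_mul_apply (c' : SymmCode) (k : Fin 2) :
    (c.mul c').perm k = c'.perm (c.perm k) := by
  rw [perm_mul, Equiv.trans_apply]

/-- **`toSymm` is multiplicative.** [folklore] -/
theorem toSymm_mul (c' : SymmCode) : (c.mul c').toSymm = c.toSymm.mul c'.toSymm := by
  simp only [toSymm, SquareSymm.mul, perm_mul]
  rfl

end SymmCode

/-! ## Single blocks, gate fields, snake tables -/

/-- **The analytic clauses of a single block** (the clauses of `IsCompatibleBlockSystem` that
concern one block `(V, Θ)` with gates `gate`, relative to the gate fields `(Vg, Θg)` and the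
margin `δ`): smoothness, incompressibility, tangency and transport on `[0,1] × [0,1]²`, zero
average and unit mass at `t = 0`, `|Θ| ≤ 10`, vanishing on the boundary strips away from the gate
windows and agreement with the gate field inside them (ACM 2019, §8.4 (a)–(c), §8.5; BDL 2023,
§4.1 (i)–(iii)). [cite: AlbertiCrippaMazzucato2019, §8.4 (a)–(c)] [cite: BrueDeLellisCMP2023, §4.1 (i)–(iii)] -/
structure IsGeneratorBlock (V : ℝ → EuclideanSpace ℝ (Fin 2) → EuclideanSpace ℝ (Fin 2))
    (Θ : ℝ → EuclideanSpace ℝ (Fin 2) → ℝ) (gate : Fin 2 → Bool → Bool)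
    (Vg : Fin 2 → ℝ → EuclideanSpace ℝ (Fin 2) → EuclideanSpace ℝ (Fin 2))
    (Θg : Fin 2 → ℝ → EuclideanSpace ℝ (Fin 2) → ℝ) (δ : ℝ) : Prop where
  /-- `V ∈ C^∞(ℝ × ℝ²)`. -/
  smooth_velocity : ContDiff ℝ ∞ (uncurry V)
  /-- `Θ ∈ C^∞(ℝ × ℝ²)`. -/
  smooth_scalar : ContDiff ℝ ∞ (uncurry Θ)
  /-- `div V(t) = 0` on `[0,1] × [0,1]²`. -/
  divFree : ∀ t ∈ Icc (0 : ℝ) 1, ∀ z ∈ closedSquare,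
    ∑ j, fderiv ℝ (V t) z (EuclideanSpace.single j 1) j = 0
  /-- `V(t)` is tangent to `∂[0,1]²`. -/
  tangent : ∀ t ∈ Icc (0 : ℝ) 1, ∀ z ∈ closedSquare, ∀ j, (z j = 0 ∨ z j = 1) → V t z j = 0
  /-- transport `∂ₜΘ + DΘ[V] = 0` on `[0,1] × [0,1]²`. -/
  transport : ∀ t ∈ Icc (0 : ℝ) 1, ∀ z ∈ closedSquare,
    deriv (fun s => Θ s z) t + fderiv ℝ (Θ t) z (V t z) = 0
  /-- zero average on the square at `t = 0`. -/
  zeroMean_zero : ∫ z in unitCube (Fin 2), Θ 0 z = 0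
  /-- unit `L²` mass on the square at `t = 0`. -/
  unitL2_zero : ∫ z in unitCube (Fin 2), Θ 0 z ^ 2 = 1
  /-- `|Θ| ≤ 10` on `[0,1] × [0,1]²`. -/
  abs_le : ∀ t ∈ Icc (0 : ℝ) 1, ∀ z ∈ closedSquare, |Θ t z| ≤ 10
  /-- vanishing on the boundary strips away from the gate windows. -/
  vanish : ∀ (t : ℝ) (z : EuclideanSpace ℝ (Fin 2)) (k : Fin 2) (s : Bool),
    |z k - faceValue s| < δ → (¬ gate k s = true ∨ ∃ j, j ≠ k ∧ δ ≤ |z j - 2⁻¹|) →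
      V t z = 0 ∧ Θ t z = 0
  /-- agreement with the gate field inside the gate windows. -/
  eq_gate : ∀ (t : ℝ) (z : EuclideanSpace ℝ (Fin 2)) (k : Fin 2) (s : Bool), gate k s = true →
    |z k - faceValue s| < δ → (∀ j, j ≠ k → |z j - 2⁻¹| < 2 * δ) →
      V t z = Vg k t (z - faceMidpoint k s) ∧ Θ t z = Θg k t (z - faceMidpoint k s)

/-- **Equivariant gate fields**: the universal gate fields are invariant under the symmetries of
the square in the form produced by `SquareSymm.eq_gate_act`,
`L_τ Vg_{perm k}(t, L_{τ⁻¹} ζ) = Vg_k(t, ζ)` and `Θg_{perm k}(t, L_{τ⁻¹} ζ) = Θg_k(t, ζ)` (ACM 2019,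
§8.4 (c), §8.6: near every crossed side the field is the canonical field of the straight line
through the midpoint, the same for all blocks and all sides). [cite: AlbertiCrippaMazzucato2019, §8.6] -/
structure IsEquivariantGateField
    (Vg : Fin 2 → ℝ → EuclideanSpace ℝ (Fin 2) → EuclideanSpace ℝ (Fin 2))
    (Θg : Fin 2 → ℝ → EuclideanSpace ℝ (Fin 2) → ℝ) : Prop where
  /-- invariance of the gate velocity -/
  velocity : ∀ (τ : SquareSymm) (k : Fin 2) (t : ℝ) (ζ : EuclideanSpace ℝ (Fin 2)),
    τ.linMap (Vg (τ.perm k) t (τ.inv.linMap ζ)) = Vg k t ζ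
  /-- invariance of the gate scalar -/
  scalar : ∀ (τ : SquareSymm) (k : Fin 2) (t : ℝ) (ζ : EuclideanSpace ℝ (Fin 2)),
    Θg (τ.perm k) t (τ.inv.linMap ζ) = Θg k t ζ

section Tables

variable (childGen : Gen → (Fin 2 → Fin 5) → Gen) (childSym : Gen → (Fin 2 → Fin 5) → SymmCode)

/-- **The gates of the child placed in the subsquare `p` of the generator `g`** by the snake table
`(childGen, childSym)`: the child is the block `σ • X_{g'}` with `g' = childGen g p`,
`σ = childSym g p`, and the face `(k, s)` of `σ • X` is the face `(perm k, s xor flip k)` of `X`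
(`SquareSymm.vanish_act`). [folklore] -/
def childGate (g : Gen) (p : Fin 2 → Fin 5) (k : Fin 2) (s : Bool) : Bool :=
  genGate (childGen g p) ((childSym g p).perm k) (xor s ((childSym g p).flip k))

/-- **Snake tables** (ACM 2019, §8.1 (a), (b), (e); §6.5): the combinatorial clauses of
`IsCompatibleBlockSystem` for the children of the two generators — horizontally/vertically
adjacent children have matching gates on their common side, and a child on the boundary of the
parent has a gate on the outer side iff it is the middle child of that side and the parent has
the gate there. All three clauses are decidable. [cite: AlbertiCrippaMazzucato2019, §8.1 (e)] -/
structure IsSnakeTable : Prop where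
  /-- adjacent children match -/
  internal : ∀ (g : Gen) (p : Fin 2 → Fin 5) (k : Fin 2) (h : (p k : ℕ) + 1 < 5),
    childGate childGen childSym g p k true =
      childGate childGen childSym g (update p k ⟨(p k : ℕ) + 1, h⟩) k false
  /-- children on the upper sides of the parent -/
  boundary_hi : ∀ (g : Gen) (p : Fin 2 → Fin 5) (k : Fin 2), (p k : ℕ) = 4 →
    (childGate childGen childSym g p k true = true ↔
      (genGate g k true = true ∧ ∀ j, j ≠ k → (p j : ℕ) = 2))
  /-- children on the lower sides of the parent -/
  boundary_lo : ∀ (g : Gen) (p : Fin 2 → Fin 5) (k : Fin 2), (p k : ℕ) = 0 →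
    (childGate childGen childSym g p k false = true ↔
      (genGate g k false = true ∧ ∀ j, j ≠ k → (p j : ℕ) = 2))

end Tables

/-! ### Equivariant gate fields from parity -/

namespace SquareSymm

variable (τ : SquareSymm)

/-- A permutation of `Fin 2` is the identity or the transposition. [folklore] -/
theorem perm_eq_refl_or_swap (σ : Equiv.Perm (Fin 2)) : σ = Equiv.refl _ ∨ σ = Equiv.swap 0 1 := by
  rcases Fin.exists_fin_two.1 ⟨σ 0, rfl⟩ with h | h
  · left
    ext i
    fin_cases i
    · simp [h]
    · have h1 : σ 1 ≠ 0 := fun h' => by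
        have := σ.injective (h'.trans h.symm); exact absurd this (by decide)
      rcases Fin.exists_fin_two.1 ⟨σ 1, rfl⟩ with h' | h'
      · exact absurd h' h1
      · simp [h']
  · right
    ext i
    fin_cases i
    · simp [h]
    · have h1 : σ 1 ≠ 1 := fun h' => by
        have := σ.injective (h'.trans h.symm); exact absurd this (by decide)
      rcases Fin.exists_fin_two.1 ⟨σ 1, rfl⟩ with h' | h'
      · simp [h']
      · exact absurd h' h1

/-- The linear part of a symmetry that does not swap the axes:
`L_τ v = (sgn 0 · v₀, sgn 1 · v₁)`. [folklore] -/
theorem linMap_eq_of_perm_eq_refl (h : τ.perm = Equiv.refl _) (v : EuclideanSpace ℝ (Fin 2)) :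
    τ.linMap v = !₂[τ.sgn 0 * v 0, τ.sgn 1 * v 1] := by
  ext k
  rw [linMap_apply, h]
  fin_cases k <;> simp

/-- The inverse linear part of a symmetry that does not swap the axes:
`L_{τ⁻¹} v = (sgn 0 · v₀, sgn 1 · v₁)`. [folklore] -/
theorem inv_linMap_eq_of_perm_eq_refl (h : τ.perm = Equiv.refl _) (v : EuclideanSpace ℝ (Fin 2)) :
    τ.inv.linMap v = !₂[τ.sgn 0 * v 0, τ.sgn 1 * v 1] := by
  ext k
  have hk : k = τ.perm k := by rw [h]; rfl
  conv_lhs => rw [hk]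
  rw [inv_linMap_apply_perm]
  fin_cases k <;> simp

/-- The linear part of a symmetry that swaps the axes: `L_τ v = (sgn 0 · v₁, sgn 1 · v₀)`. [folklore] -/
theorem linMap_eq_of_perm_eq_swap (h : τ.perm = Equiv.swap 0 1) (v : EuclideanSpace ℝ (Fin 2)) :
    τ.linMap v = !₂[τ.sgn 0 * v 1, τ.sgn 1 * v 0] := by
  ext k
  rw [linMap_apply, h]
  fin_cases k <;> simp

/-- The inverse linear part of a symmetry that swaps the axes:
`L_{τ⁻¹} v = (sgn 1 · v₁, sgn 0 · v₀)`. [folklore] -/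
theorem inv_linMap_eq_of_perm_eq_swap (h : τ.perm = Equiv.swap 0 1) (v : EuclideanSpace ℝ (Fin 2)) :
    τ.inv.linMap v = !₂[τ.sgn 1 * v 1, τ.sgn 0 * v 0] := by
  ext k
  fin_cases k
  · have hk : (0 : Fin 2) = τ.perm 1 := by rw [h]; rfl
    simp only [Fin.zero_eta]
    conv_lhs => rw [hk]
    rw [inv_linMap_apply_perm]
    simp
  · have hk : (1 : Fin 2) = τ.perm 0 := by rw [h]; rfl
    simp only [Fin.mk_one]
    conv_lhs => rw [hk]
    rw [inv_linMap_apply_perm]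
    simp

/-- The axes at a permuted index, no swap. [folklore] -/
theorem perm_apply_of_perm_eq_refl (h : τ.perm = Equiv.refl _) (k : Fin 2) : τ.perm k = k := by
  rw [h]; rfl

end SquareSymm

section Parity

variable {Vg : Fin 2 → ℝ → EuclideanSpace ℝ (Fin 2) → EuclideanSpace ℝ (Fin 2)}
  {Θg : Fin 2 → ℝ → EuclideanSpace ℝ (Fin 2) → ℝ}

/-- A point of the plane is the literal of its two coordinates. [folklore] -/
theorem eq_euclidean_lit (ζ : EuclideanSpace ℝ (Fin 2)) : ζ = !₂[ζ 0, ζ 1] := by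
  ext k; fin_cases k <;> simp

/-- Sign changes of the coordinates act on an axis-`0` gate velocity with the two parities
(odd normal component under the flip of the normal coordinate, odd transversal component under
the flip of the transversal coordinate) by the same sign changes of its components. [folklore] -/
theorem gateVelocity_signs
    (hV₀ : ∀ (t : ℝ) (ζ : EuclideanSpace ℝ (Fin 2)),
      Vg 0 t !₂[-ζ 0, ζ 1] = !₂[-(Vg 0 t ζ 0), Vg 0 t ζ 1])
    (hV₁ : ∀ (t : ℝ) (ζ : EuclideanSpace ℝ (Fin 2)),
      Vg 0 t !₂[ζ 0, -ζ 1] = !₂[Vg 0 t ζ 0, -(Vg 0 t ζ 1)])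
    (τ : SquareSymm) (i j : Fin 2) (t : ℝ) (ζ : EuclideanSpace ℝ (Fin 2)) :
    Vg 0 t !₂[τ.sgn i * ζ 0, τ.sgn j * ζ 1] =
      !₂[τ.sgn i * Vg 0 t ζ 0, τ.sgn j * Vg 0 t ζ 1] := by
  have key₁ : Vg 0 t !₂[ζ 0, -ζ 1] 0 = Vg 0 t ζ 0 ∧ Vg 0 t !₂[ζ 0, -ζ 1] 1 = -(Vg 0 t ζ 1) := by
    rw [hV₁]; simp
  unfold SquareSymm.sgn
  split_ifs with hi hj hj
  · -- both flipped: flip the normal coordinate of the transversally flipped point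
    have h := hV₀ t !₂[ζ 0, -ζ 1]
    simp only [Matrix.cons_val_zero, Matrix.cons_val_one] at h
    rw [key₁.1, key₁.2] at h
    simpa using h
  · simpa using hV₀ t ζ
  · simpa using hV₁ t ζ
  · simp [← eq_euclidean_lit]

/-- Sign changes of the coordinates leave an even axis-`0` gate scalar unchanged. [folklore] -/
theorem gateScalar_signs
    (hΘ₀ : ∀ (t : ℝ) (ζ : EuclideanSpace ℝ (Fin 2)), Θg 0 t !₂[-ζ 0, ζ 1] = Θg 0 t ζ)
    (hΘ₁ : ∀ (t : ℝ) (ζ : EuclideanSpace ℝ (Fin 2)), Θg 0 t !₂[ζ 0, -ζ 1] = Θg 0 t ζ)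
    (τ : SquareSymm) (i j : Fin 2) (t : ℝ) (ζ : EuclideanSpace ℝ (Fin 2)) :
    Θg 0 t !₂[τ.sgn i * ζ 0, τ.sgn j * ζ 1] = Θg 0 t ζ := by
  unfold SquareSymm.sgn
  split_ifs with hi hj hj
  · have h := hΘ₀ t !₂[ζ 0, -ζ 1]
    simp only [Matrix.cons_val_zero, Matrix.cons_val_one] at h
    rw [hΘ₁] at h
    simpa using h
  · simpa using hΘ₀ t ζ
  · simpa using hΘ₁ t ζ
  · simp [← eq_euclidean_lit]

/-- **Equivariant gate fields from parity** (a constructor for `IsEquivariantGateField`): it is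
enough that the axis-`0` gate velocity has odd normal component under the flip of the normal
coordinate `ζ₀ ↦ -ζ₀` and odd transversal component under the flip of the transversal coordinate
`ζ₁ ↦ -ζ₁` (the other components being even), that the axis-`0` gate scalar is even in both
coordinates, and that the axis-`1` gate fields are the axis-`0` ones conjugated by the swap of
the coordinates — the parities of the canonical field of a straight channel through the midpoint
of a side (ACM 2019, §8.4 (c), §8.6). [cite: AlbertiCrippaMazzucato2019, §8.6] -/
theorem IsEquivariantGateField.of_parity
    (hV₀ : ∀ (t : ℝ) (ζ : EuclideanSpace ℝ (Fin 2)),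
      Vg 0 t !₂[-ζ 0, ζ 1] = !₂[-(Vg 0 t ζ 0), Vg 0 t ζ 1])
    (hV₁ : ∀ (t : ℝ) (ζ : EuclideanSpace ℝ (Fin 2)),
      Vg 0 t !₂[ζ 0, -ζ 1] = !₂[Vg 0 t ζ 0, -(Vg 0 t ζ 1)])
    (hVs : ∀ (t : ℝ) (ζ : EuclideanSpace ℝ (Fin 2)),
      Vg 1 t ζ = !₂[Vg 0 t !₂[ζ 1, ζ 0] 1, Vg 0 t !₂[ζ 1, ζ 0] 0])
    (hΘ₀ : ∀ (t : ℝ) (ζ : EuclideanSpace ℝ (Fin 2)), Θg 0 t !₂[-ζ 0, ζ 1] = Θg 0 t ζ)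
    (hΘ₁ : ∀ (t : ℝ) (ζ : EuclideanSpace ℝ (Fin 2)), Θg 0 t !₂[ζ 0, -ζ 1] = Θg 0 t ζ)
    (hΘs : ∀ (t : ℝ) (ζ : EuclideanSpace ℝ (Fin 2)), Θg 1 t ζ = Θg 0 t !₂[ζ 1, ζ 0]) :
    IsEquivariantGateField Vg Θg := by
  have hsq : ∀ (τ : SquareSymm) (k : Fin 2) (a : ℝ), τ.sgn k * (τ.sgn k * a) = a := fun τ k a => by
    rw [← mul_assoc, τ.sgn_mul_self, one_mul]
  have hVsig := gateVelocity_signs hV₀ hV₁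
  have hΘsig := gateScalar_signs hΘ₀ hΘ₁
  refine ⟨fun τ k t ζ => ?_, fun τ k t ζ => ?_⟩
  · -- velocity
    rcases SquareSymm.perm_eq_refl_or_swap τ.perm with h | h
    · rw [τ.inv_linMap_eq_of_perm_eq_refl h, τ.perm_apply_of_perm_eq_refl h]
      fin_cases k
      · simp only [Fin.zero_eta]
        rw [hVsig, τ.linMap_eq_of_perm_eq_refl h]
        simp only [Matrix.cons_val_zero, Matrix.cons_val_one, hsq]
        exact (eq_euclidean_lit _).symm
      · simp only [Fin.mk_one]
        rw [hVs, τ.linMap_eq_of_perm_eq_refl h]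
        have h' := hVsig τ 1 0 t !₂[ζ 1, ζ 0]
        simp only [Matrix.cons_val_zero, Matrix.cons_val_one] at h' ⊢
        rw [h', hVs t ζ]
        simp [hsq]
    · have hp0 : τ.perm 0 = 1 := by rw [h]; rfl
      have hp1 : τ.perm 1 = 0 := by rw [h]; rfl
      rw [τ.inv_linMap_eq_of_perm_eq_swap h]
      fin_cases k
      · simp only [Fin.zero_eta]
        rw [hp0, hVs, τ.linMap_eq_of_perm_eq_swap h]
        simp only [Matrix.cons_val_zero, Matrix.cons_val_one]
        rw [hVsig]
        simp only [Matrix.cons_val_zero, Matrix.cons_val_one, hsq]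
        exact (eq_euclidean_lit _).symm
      · simp only [Fin.mk_one]
        rw [hp1, τ.linMap_eq_of_perm_eq_swap h]
        have h' := hVsig τ 1 0 t !₂[ζ 1, ζ 0]
        simp only [Matrix.cons_val_zero, Matrix.cons_val_one] at h' ⊢
        rw [h', hVs t ζ]
        simp [hsq]
  · -- scalar
    rcases SquareSymm.perm_eq_refl_or_swap τ.perm with h | h
    · rw [τ.inv_linMap_eq_of_perm_eq_refl h, τ.perm_apply_of_perm_eq_refl h]
      fin_cases k
      · simp only [Fin.zero_eta]
        rw [hΘsig]
      · simp only [Fin.mk_one]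
        rw [hΘs, hΘs t ζ]
        have h' := hΘsig τ 1 0 t !₂[ζ 1, ζ 0]
        simp only [Matrix.cons_val_zero, Matrix.cons_val_one] at h' ⊢
        rw [h']
    · have hp0 : τ.perm 0 = 1 := by rw [h]; rfl
      have hp1 : τ.perm 1 = 0 := by rw [h]; rfl
      rw [τ.inv_linMap_eq_of_perm_eq_swap h]
      fin_cases k
      · simp only [Fin.zero_eta]
        rw [hp0, hΘs]
        simp only [Matrix.cons_val_zero, Matrix.cons_val_one]
        rw [hΘsig]
      · simp only [Fin.mk_one]
        rw [hp1, hΘs t ζ]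
        have h' := hΘsig τ 1 0 t !₂[ζ 1, ζ 0]
        simp only [Matrix.cons_val_zero, Matrix.cons_val_one] at h' ⊢
        rw [h']

end Parity

/-! ## The induced block system -/

/-- The blocks of the induced system: a generator moved by a coded symmetry. [folklore] -/
abbrev Block : Type := Gen × SymmCode

section Induced

variable (V₀ : Gen → ℝ → EuclideanSpace ℝ (Fin 2) → EuclideanSpace ℝ (Fin 2))
  (Θ₀ : Gen → ℝ → EuclideanSpace ℝ (Fin 2) → ℝ)
  (childGen : Gen → (Fin 2 → Fin 5) → Gen) (childSym : Gen → (Fin 2 → Fin 5) → SymmCode)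

/-- The velocity of the block `(g, c)`: `c • V_g`. [cite: AlbertiCrippaMazzucato2019, §6.5] -/
def blockV (b : Block) : ℝ → EuclideanSpace ℝ (Fin 2) → EuclideanSpace ℝ (Fin 2) :=
  b.2.toSymm.actVelocity (V₀ b.1)

/-- The scalar of the block `(g, c)`: `c • Θ_g`. [cite: AlbertiCrippaMazzucato2019, §6.5] -/
def blockΘ (b : Block) : ℝ → EuclideanSpace ℝ (Fin 2) → ℝ :=
  b.2.toSymm.actScalar (Θ₀ b.1)

/-- The gates of the block `(g, c)`: the face `(k, s)` of `c • X_g` is the face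
`(perm k, s xor flip k)` of `X_g`. [folklore] -/
def blockGate (b : Block) (k : Fin 2) (s : Bool) : Bool :=
  genGate b.1 (b.2.perm k) (xor s (b.2.flip k))

/-- The child of the block `(g, c)` in the subsquare `p`: the subsquare `p` of `c • X_g` is the
image of the subsquare `p' = subIdx c p` of `X_g`, whose child `(g', σ)` is read off the table;
the child block is `(g', c σ)` (`SquareSymm.actScalar_selfSimilar_mul`). [cite: AlbertiCrippaMazzucato2019, §8.1 (e)] -/
def blockChild (b : Block) (p : Fin 2 → Fin 5) : Block :=
  (childGen b.1 (b.2.toSymm.subIdx p), b.2.mul (childSym b.1 (b.2.toSymm.subIdx p)))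

/-- **The seed** (ACM 2019, §6.5, Fig. 6: four bent channels forming a circular channel on
`𝒬(2)`): the square `q ∈ {0,1}²` carries the bent channel flipped towards the centre of
`[0,1]²` — axis `k` is flipped iff `q_k = 0`, so that its gates are exactly its two internal
sides. [cite: AlbertiCrippaMazzucato2019, §6.5] -/
def seedBlock (q : Fin 2 → Fin 2) : Block :=
  (.B, ⟨false, fun k => decide ((q k : ℕ) = 0)⟩)

variable {V₀ Θ₀ childGen childSym}

/-- Gates of an induced child, read off the snake table:
`gate(child (g,c) p)(k, s) = childGate g (subIdx c p) (perm_c k) (s xor flip_c k)`. [folklore] -/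
theorem blockGate_blockChild (b : Block) (p : Fin 2 → Fin 5) (k : Fin 2) (s : Bool) :
    blockGate (blockChild childGen childSym b p) k s =
      childGate childGen childSym b.1 (b.2.toSymm.subIdx p) (b.2.perm k) (xor s (b.2.flip k)) := by
  simp only [blockGate, blockChild, childGate, SymmCode.perm_mul_apply, SymmCode.flip_mul,
    Bool.xor_assoc]

/-! ### Subsquare indices under the symmetries -/

namespace SquareSymm

variable (τ : SquareSymm)

/-- `subIdx` commutes with updating one coordinate (the updated axis is permuted, the new value
reversed iff the axis is flipped). [folklore] -/
theorem subIdx_update (p : Fin 2 → Fin 5) (k : Fin 2) (v : Fin 5) :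
    τ.subIdx (update p k v) = update (τ.subIdx p) (τ.perm k) (if τ.flip k then v.rev else v) := by
  funext j
  obtain ⟨i, rfl⟩ := τ.perm.surjective j
  rw [subIdx_apply_perm]
  by_cases hik : i = k
  · subst hik
    simp
  · have hne : τ.perm i ≠ τ.perm k := fun h => hik (τ.perm.injective h)
    rw [update_of_ne hik, update_of_ne hne, subIdx_apply_perm]

/-- The value `2` (the middle) is fixed: `(subIdx τ p)_{perm i} = 2 ↔ p_i = 2`. [folklore] -/
theorem subIdx_apply_perm_eq_two (p : Fin 2 → Fin 5) (i : Fin 2) :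
    ((τ.subIdx p (τ.perm i) : ℕ) = 2) ↔ ((p i : ℕ) = 2) := by
  rw [subIdx_apply_perm]
  split_ifs
  · rw [Fin.val_rev]; have := (p i).isLt; omega
  · exact Iff.rfl

/-- The middle condition transfers: `(∀ j ≠ perm k, (subIdx τ p)_j = 2) ↔ (∀ j ≠ k, p_j = 2)`. [folklore] -/
theorem forall_subIdx_eq_two_iff (p : Fin 2 → Fin 5) (k : Fin 2) :
    (∀ j, j ≠ τ.perm k → ((τ.subIdx p j : ℕ) = 2)) ↔ (∀ j, j ≠ k → ((p j : ℕ) = 2)) := by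
  constructor
  · intro h j hj
    have hne : τ.perm j ≠ τ.perm k := fun h' => hj (τ.perm.injective h')
    exact (τ.subIdx_apply_perm_eq_two p j).1 (h _ hne)
  · intro h j hj
    obtain ⟨i, rfl⟩ := τ.perm.surjective j
    have hik : i ≠ k := fun h' => hj (by rw [h'])
    exact (τ.subIdx_apply_perm_eq_two p i).2 (h i hik)

end SquareSymm

/-! ### The combinatorial clauses of the induced system -/

section Combinatorics

variable (hT : IsSnakeTable childGen childSym)
include hT

/-- **Adjacent induced children match.** [folklore] -/
theorem blockChild_internal (b : Block) (p : Fin 2 → Fin 5) (k : Fin 2) (h : (p k : ℕ) + 1 < 5) :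
    (blockGate (blockChild childGen childSym b p) k true = true ↔
      blockGate (blockChild childGen childSym b (update p k ⟨(p k : ℕ) + 1, h⟩)) k false = true) := by
  obtain ⟨g, c⟩ := b
  set τ := c.toSymm with hτ
  rw [blockGate_blockChild, blockGate_blockChild]
  simp only
  rw [τ.subIdx_update]
  have hperm : c.perm = τ.perm := rfl
  have hflip : c.flip = τ.flip := rfl
  rw [hperm, hflip]
  cases hf : τ.flip k
  · -- no flip: the table clause at the image cell, same orientation
    simp only [Bool.xor_false, if_false, Bool.false_eq_true]
    have hval : (τ.subIdx p (τ.perm k) : ℕ) = (p k : ℕ) := by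
      rw [τ.subIdx_apply_perm, hf]; rfl
    have h' : (τ.subIdx p (τ.perm k) : ℕ) + 1 < 5 := by rw [hval]; exact h
    have key := hT.internal g (τ.subIdx p) (τ.perm k) h'
    have hv : (⟨(τ.subIdx p (τ.perm k) : ℕ) + 1, h'⟩ : Fin 5) = ⟨(p k : ℕ) + 1, h⟩ :=
      Fin.ext (by simp [hval])
    rw [hv] at key
    rw [key]
  · -- flip: the table clause at the image of the neighbour, reversed orientation
    simp only [Bool.xor_true, if_true, Bool.not_true, Bool.not_false]
    set q := update (τ.subIdx p) (τ.perm k) (Fin.rev ⟨(p k : ℕ) + 1, h⟩) with hq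
    have hqk : (q (τ.perm k) : ℕ) = 4 - ((p k : ℕ) + 1) := by
      rw [hq, update_self, Fin.val_rev]
      have hv : ((⟨(p k : ℕ) + 1, h⟩ : Fin 5) : ℕ) = (p k : ℕ) + 1 := rfl
      omega
    have hq' : (q (τ.perm k) : ℕ) + 1 < 5 := by rw [hqk]; omega
    have hback : update q (τ.perm k) ⟨(q (τ.perm k) : ℕ) + 1, hq'⟩ = τ.subIdx p := by
      funext j
      by_cases hj : j = τ.perm k
      · subst hj
        rw [update_self, τ.subIdx_apply_perm, hf]
        simp only [if_true]
        apply Fin.ext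
        rw [Fin.val_rev]
        simp only [hqk]
        omega
      · rw [update_of_ne hj, hq, update_of_ne hj]
    have key := hT.internal g q (τ.perm k) hq'
    rw [hback] at key
    rw [key]

/-- **Induced children on the upper sides of the parent.** [folklore] -/
theorem blockChild_boundary_hi (b : Block) (p : Fin 2 → Fin 5) (k : Fin 2) (hp : (p k : ℕ) = 4) :
    (blockGate (blockChild childGen childSym b p) k true = true ↔
      (blockGate b k true = true ∧ ∀ j, j ≠ k → (p j : ℕ) = 2)) := by
  obtain ⟨g, c⟩ := b
  set τ := c.toSymm with hτ
  rw [blockGate_blockChild]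
  simp only [blockGate]
  have hperm : c.perm = τ.perm := rfl
  have hflip : c.flip = τ.flip := rfl
  rw [hperm, hflip, ← τ.forall_subIdx_eq_two_iff p k]
  cases hf : τ.flip k
  · simp only [Bool.xor_false]
    have hval : (τ.subIdx p (τ.perm k) : ℕ) = 4 := by
      rw [τ.subIdx_apply_perm, hf]; exact hp
    exact hT.boundary_hi g (τ.subIdx p) (τ.perm k) hval
  · simp only [Bool.xor_true, Bool.not_true]
    have hval : (τ.subIdx p (τ.perm k) : ℕ) = 0 := by
      rw [τ.subIdx_apply_perm, hf]
      simp only [if_true, Fin.val_rev, hp]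
    exact hT.boundary_lo g (τ.subIdx p) (τ.perm k) hval

/-- **Induced children on the lower sides of the parent.** [folklore] -/
theorem blockChild_boundary_lo (b : Block) (p : Fin 2 → Fin 5) (k : Fin 2) (hp : (p k : ℕ) = 0) :
    (blockGate (blockChild childGen childSym b p) k false = true ↔
      (blockGate b k false = true ∧ ∀ j, j ≠ k → (p j : ℕ) = 2)) := by
  obtain ⟨g, c⟩ := b
  set τ := c.toSymm with hτ
  rw [blockGate_blockChild]
  simp only [blockGate]
  have hperm : c.perm = τ.perm := rfl
  have hflip : c.flip = τ.flip := rfl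
  rw [hperm, hflip, ← τ.forall_subIdx_eq_two_iff p k]
  cases hf : τ.flip k
  · simp only [Bool.xor_false]
    have hval : (τ.subIdx p (τ.perm k) : ℕ) = 0 := by
      rw [τ.subIdx_apply_perm, hf]; exact hp
    exact hT.boundary_lo g (τ.subIdx p) (τ.perm k) hval
  · simp only [Bool.xor_true, Bool.not_false]
    have hval : (τ.subIdx p (τ.perm k) : ℕ) = 4 := by
      rw [τ.subIdx_apply_perm, hf]
      simp only [if_true, Fin.val_rev, hp]
    exact hT.boundary_hi g (τ.subIdx p) (τ.perm k) hval

end Combinatorics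

/-- The seed squares match across the internal sides of `𝒬(2)`. [cite: AlbertiCrippaMazzucato2019, §6.5] -/
theorem seedBlock_internal (q : Fin 2 → Fin 2) (k : Fin 2) (h : (q k : ℕ) + 1 < 2) :
    (blockGate (seedBlock q) k true = true ↔
      blockGate (seedBlock (update q k ⟨(q k : ℕ) + 1, h⟩)) k false = true) := by
  have hq : q k = 0 := Fin.ext (by simp only [Fin.val_zero]; omega)
  simp [blockGate, seedBlock, hq]

/-- No seed gate on the upper outer sides of `[0,1]²`. [cite: AlbertiCrippaMazzucato2019, §6.5] -/
theorem seedBlock_boundary_hi (q : Fin 2 → Fin 2) (k : Fin 2) (h : (q k : ℕ) = 1) :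
    ¬ blockGate (seedBlock q) k true = true := by
  have hq : q k ≠ 0 := fun h0 => by simp [h0] at h
  simp [blockGate, seedBlock, hq]

/-- No seed gate on the lower outer sides of `[0,1]²`. [cite: AlbertiCrippaMazzucato2019, §6.5] -/
theorem seedBlock_boundary_lo (q : Fin 2 → Fin 2) (k : Fin 2) (h : (q k : ℕ) = 0) :
    ¬ blockGate (seedBlock q) k false = true := by
  have hq : q k = 0 := Fin.ext (by simp only [Fin.val_zero]; omega)
  simp [blockGate, seedBlock, hq]

/-! ### The analytic clauses of the induced system -/

section Analytic

variable {Vg : Fin 2 → ℝ → EuclideanSpace ℝ (Fin 2) → EuclideanSpace ℝ (Fin 2)}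
  {Θg : Fin 2 → ℝ → EuclideanSpace ℝ (Fin 2) → ℝ} {δ : ℝ}

/-- Slices of a jointly smooth field are differentiable. [folklore] -/
theorem differentiableAt_slice_of_contDiff_uncurry {F : Type*} [NormedAddCommGroup F]
    [NormedSpace ℝ F] {u : ℝ → EuclideanSpace ℝ (Fin 2) → F} (h : ContDiff ℝ ∞ (uncurry u))
    (t : ℝ) (x : EuclideanSpace ℝ (Fin 2)) : DifferentiableAt ℝ (u t) x := by
  have h1 : ContDiff ℝ ∞ (u t) := h.comp (contDiff_const.prodMk contDiff_id)
  exact (h1.differentiable (by simp)) x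

variable (hB : ∀ g, IsGeneratorBlock (V₀ g) (Θ₀ g) (genGate g) Vg Θg δ)
include hB

/-- Induced velocities are smooth. [folklore] -/
theorem contDiff_blockV (b : Block) : ContDiff ℝ ∞ (uncurry (blockV V₀ b)) :=
  b.2.toSymm.contDiff_actVelocity (hB b.1).smooth_velocity

/-- Induced scalars are smooth. [folklore] -/
theorem contDiff_blockΘ (b : Block) : ContDiff ℝ ∞ (uncurry (blockΘ Θ₀ b)) :=
  b.2.toSymm.contDiff_actScalar (hB b.1).smooth_scalar

/-- Induced velocities are divergence free on `[0,1] × [0,1]²`. [folklore] -/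
theorem divFree_blockV (b : Block) {t : ℝ} (ht : t ∈ Icc (0 : ℝ) 1)
    {z : EuclideanSpace ℝ (Fin 2)} (hz : z ∈ closedSquare) :
    ∑ j, fderiv ℝ (blockV V₀ b t) z (EuclideanSpace.single j 1) j = 0 := by
  have hd := differentiableAt_slice_of_contDiff_uncurry (hB b.1).smooth_velocity t
    (b.2.toSymm.inv.act z)
  unfold blockV
  rw [b.2.toSymm.divergence_act hd]
  exact (hB b.1).divFree t ht _ (b.2.toSymm.inv.act_mem_closedSquare hz)

/-- Induced velocities are tangent to the boundary. [folklore] -/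
theorem tangent_blockV (b : Block) {t : ℝ} (ht : t ∈ Icc (0 : ℝ) 1)
    {z : EuclideanSpace ℝ (Fin 2)} (hz : z ∈ closedSquare) (j : Fin 2) (hj : z j = 0 ∨ z j = 1) :
    blockV V₀ b t z j = 0 :=
  b.2.toSymm.tangent_act ((hB b.1).tangent t ht) hz j hj

/-- Induced scalars are transported. [folklore] -/
theorem transport_block (b : Block) {t : ℝ} (ht : t ∈ Icc (0 : ℝ) 1)
    {z : EuclideanSpace ℝ (Fin 2)} (hz : z ∈ closedSquare) :
    deriv (fun s => blockΘ Θ₀ b s z) t + fderiv ℝ (blockΘ Θ₀ b t) z (blockV V₀ b t z) = 0 := by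
  have hd := differentiableAt_slice_of_contDiff_uncurry (hB b.1).smooth_scalar t
    (b.2.toSymm.inv.act z)
  unfold blockΘ blockV
  rw [b.2.toSymm.transport_act hd]
  exact (hB b.1).transport t ht _ (b.2.toSymm.inv.act_mem_closedSquare hz)

/-- Induced scalars have zero average at `t = 0`. [folklore] -/
theorem zeroMean_blockΘ (b : Block) : ∫ z in unitCube (Fin 2), blockΘ Θ₀ b 0 z = 0 := by
  unfold blockΘ
  rw [b.2.toSymm.setIntegral_actScalar]
  exact (hB b.1).zeroMean_zero

/-- Induced scalars have unit mass at `t = 0`. [folklore] -/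
theorem unitL2_blockΘ (b : Block) : ∫ z in unitCube (Fin 2), blockΘ Θ₀ b 0 z ^ 2 = 1 := by
  unfold blockΘ
  rw [b.2.toSymm.setIntegral_actScalar_sq]
  exact (hB b.1).unitL2_zero

/-- Induced scalars are bounded by `10`. [folklore] -/
theorem abs_blockΘ_le (b : Block) {t : ℝ} (ht : t ∈ Icc (0 : ℝ) 1)
    {z : EuclideanSpace ℝ (Fin 2)} (hz : z ∈ closedSquare) : |blockΘ Θ₀ b t z| ≤ 10 := by
  unfold blockΘ
  rw [SquareSymm.actScalar_apply]
  exact (hB b.1).abs_le t ht _ (b.2.toSymm.inv.act_mem_closedSquare hz)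

/-- Induced blocks vanish on the boundary strips away from their gate windows. [folklore] -/
theorem vanish_block (b : Block) (t : ℝ) (z : EuclideanSpace ℝ (Fin 2)) (k : Fin 2) (s : Bool)
    (hz : |z k - faceValue s| < δ)
    (hg : ¬ blockGate b k s = true ∨ ∃ j, j ≠ k ∧ δ ≤ |z j - 2⁻¹|) :
    blockV V₀ b t z = 0 ∧ blockΘ Θ₀ b t z = 0 :=
  b.2.toSymm.vanish_act (gate := fun k s => genGate b.1 k s = true) (hB b.1).vanish t z k s hz hg

variable (hG : IsEquivariantGateField Vg Θg)
include hG

/-- Induced blocks agree with the (equivariant) gate fields inside their gate windows. [folklore] -/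
theorem eq_gate_block (b : Block) (t : ℝ) (z : EuclideanSpace ℝ (Fin 2)) (k : Fin 2) (s : Bool)
    (hg : blockGate b k s = true) (hz : |z k - faceValue s| < δ)
    (hw : ∀ j, j ≠ k → |z j - 2⁻¹| < 2 * δ) :
    blockV V₀ b t z = Vg k t (z - faceMidpoint k s) ∧
      blockΘ Θ₀ b t z = Θg k t (z - faceMidpoint k s) := by
  obtain ⟨hV, hΘ⟩ := b.2.toSymm.eq_gate_act (gate := fun k s => genGate b.1 k s = true)
    (hB b.1).eq_gate t z k s hg hz hw
  refine ⟨?_, ?_⟩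
  · unfold blockV; rw [hV, hG.velocity]
  · unfold blockΘ; rw [hΘ, hG.scalar]

end Analytic

/-- **Self-similarity of the induced blocks** from generator-level self-similarity. [folklore] -/
theorem selfSimilar_block
    (hS : ∀ (g : Gen) (p : Fin 2 → Fin 5), ∀ z ∈ latticeCellInterior 5 (fun k => ((p k : ℕ) : ℤ)),
      Θ₀ g 1 z = (childSym g p).toSymm.actScalar (Θ₀ (childGen g p)) 0
        ((5 : ℝ) • z - latticeVec (fun k => ((p k : ℕ) : ℤ))))
    (b : Block) (p : Fin 2 → Fin 5) {z : EuclideanSpace ℝ (Fin 2)}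
    (hz : z ∈ latticeCellInterior 5 (fun k => ((p k : ℕ) : ℤ))) :
    blockΘ Θ₀ b 1 z = blockΘ Θ₀ (blockChild childGen childSym b p) 0
      ((5 : ℝ) • z - latticeVec (fun k => ((p k : ℕ) : ℤ))) := by
  obtain ⟨g, c⟩ := b
  unfold blockΘ blockChild
  simp only
  rw [SymmCode.toSymm_mul]
  exact c.toSymm.actScalar_selfSimilar_mul (hS g (c.toSymm.subIdx p)) hz

end Induced

/-! ## An admissible snake table -/

section Example

/-- **An admissible snake table, child types** (one Hamiltonian arrangement of the `25`
children of each generator compatible with `IsSnakeTable`; cells are indexed `p = (column, row)`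
from the lower left corner). The straight generator `S` (entering through the left side of the
cell `(0,2)`, leaving through the right side of `(4,2)`) visits, in this order (rows listed from
the top, `S` = straight child, `L`/`R` = bent child turning left/right),
```
 2R  3S  4S  5S  6R
 1S 10L  9S  8S  7R
 0L 11L 12S 13R 24R
17L 16S 15S 14R 23S
18L 19S 20S 21S 22L
```
(a path invariant under the rotation by `π` about the centre, as the symmetric first stage of
ACM 2019, §8.10 requires), and the bent generator `B` (entering through the left side of `(0,2)`,
leaving through the bottom side of `(2,0)`) visits
```
 8R  9S 10S 11S 12R
 7R  6S  5S  4L 13S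
 0S  1S  2S  3L 14S
21L 20S 19S 18L 15S
22L 23S 24R 17R 16R
```
This is an example of the combinatorics of ACM 2019, §8.2 (the authors' own arrangement is the
one drawn in their Fig. 7, not reproduced here); any table satisfying `IsSnakeTable` can be fed
to `acm_compatible_blocks_of_generators`. [cite: AlbertiCrippaMazzucato2019, §8.2] -/
def peanoChildGen (g : Gen) (p : Fin 2 → Fin 5) : Gen :=
  match g, (p 0 : ℕ), (p 1 : ℕ) with
  | .S, 0, 0 => .B
  | .S, 0, 1 => .B
  | .S, 0, 2 => .B
  | .S, 0, 3 => .S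
  | .S, 0, 4 => .B
  | .S, 1, 0 => .S
  | .S, 1, 1 => .S
  | .S, 1, 2 => .B
  | .S, 1, 3 => .B
  | .S, 1, 4 => .S
  | .S, 2, 0 => .S
  | .S, 2, 1 => .S
  | .S, 2, 2 => .S
  | .S, 2, 3 => .S
  | .S, 2, 4 => .S
  | .S, 3, 0 => .S
  | .S, 3, 1 => .B
  | .S, 3, 2 => .B
  | .S, 3, 3 => .S
  | .S, 3, 4 => .S
  | .S, 4, 0 => .B
  | .S, 4, 1 => .S
  | .S, 4, 2 => .B
  | .S, 4, 3 => .B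
  | .S, 4, 4 => .B
  | .B, 0, 0 => .B
  | .B, 0, 1 => .B
  | .B, 0, 2 => .S
  | .B, 0, 3 => .B
  | .B, 0, 4 => .B
  | .B, 1, 0 => .S
  | .B, 1, 1 => .S
  | .B, 1, 2 => .S
  | .B, 1, 3 => .S
  | .B, 1, 4 => .S
  | .B, 2, 0 => .B
  | .B, 2, 1 => .S
  | .B, 2, 2 => .S
  | .B, 2, 3 => .S
  | .B, 2, 4 => .S
  | .B, 3, 0 => .B
  | .B, 3, 1 => .B
  | .B, 3, 2 => .B
  | .B, 3, 3 => .B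
  | .B, 3, 4 => .S
  | .B, 4, 0 => .B
  | .B, 4, 1 => .S
  | .B, 4, 2 => .S
  | .B, 4, 3 => .S
  | .B, 4, 4 => .B
  | _, _, _ => .S

/-- **An admissible snake table, child positions**: the symmetry code of each child of
`peanoChildGen` — straight children traversed vertically are the straight generator with the
axes swapped, bent children are the bent generator with the axis `k` flipped iff their gate on
that axis is the upper face (no swaps); the codes only fix the gates, a geometric realisation may
replace them by any codes with the same gates. [cite: AlbertiCrippaMazzucato2019, §8.2] -/
def peanoChildSym (g : Gen) (p : Fin 2 → Fin 5) : SymmCode :=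
  match g, (p 0 : ℕ), (p 1 : ℕ) with
  | .S, 0, 0 => ⟨false, ![true, true]⟩
  | .S, 0, 1 => ⟨false, ![true, false]⟩
  | .S, 0, 2 => ⟨false, ![false, true]⟩
  | .S, 0, 3 => ⟨true, ![false, false]⟩
  | .S, 0, 4 => ⟨false, ![true, false]⟩
  | .S, 1, 0 => ⟨false, ![false, false]⟩
  | .S, 1, 1 => ⟨false, ![false, false]⟩
  | .S, 1, 2 => ⟨false, ![true, true]⟩
  | .S, 1, 3 => ⟨false, ![true, false]⟩
  | .S, 1, 4 => ⟨false, ![false, false]⟩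
  | .S, 2, 0 => ⟨false, ![false, false]⟩
  | .S, 2, 1 => ⟨false, ![false, false]⟩
  | .S, 2, 2 => ⟨false, ![false, false]⟩
  | .S, 2, 3 => ⟨false, ![false, false]⟩
  | .S, 2, 4 => ⟨false, ![false, false]⟩
  | .S, 3, 0 => ⟨false, ![false, false]⟩
  | .S, 3, 1 => ⟨false, ![false, true]⟩
  | .S, 3, 2 => ⟨false, ![false, false]⟩
  | .S, 3, 3 => ⟨false, ![false, false]⟩
  | .S, 3, 4 => ⟨false, ![false, false]⟩
  | .S, 4, 0 => ⟨false, ![false, true]⟩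
  | .S, 4, 1 => ⟨true, ![false, false]⟩
  | .S, 4, 2 => ⟨false, ![true, false]⟩
  | .S, 4, 3 => ⟨false, ![false, true]⟩
  | .S, 4, 4 => ⟨false, ![false, false]⟩
  | .B, 0, 0 => ⟨false, ![true, true]⟩
  | .B, 0, 1 => ⟨false, ![true, false]⟩
  | .B, 0, 2 => ⟨false, ![false, false]⟩
  | .B, 0, 3 => ⟨false, ![true, true]⟩
  | .B, 0, 4 => ⟨false, ![true, false]⟩
  | .B, 1, 0 => ⟨false, ![false, false]⟩
  | .B, 1, 1 => ⟨false, ![false, false]⟩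
  | .B, 1, 2 => ⟨false, ![false, false]⟩
  | .B, 1, 3 => ⟨false, ![false, false]⟩
  | .B, 1, 4 => ⟨false, ![false, false]⟩
  | .B, 2, 0 => ⟨false, ![false, false]⟩
  | .B, 2, 1 => ⟨false, ![false, false]⟩
  | .B, 2, 2 => ⟨false, ![false, false]⟩
  | .B, 2, 3 => ⟨false, ![false, false]⟩
  | .B, 2, 4 => ⟨false, ![false, false]⟩
  | .B, 3, 0 => ⟨false, ![true, true]⟩
  | .B, 3, 1 => ⟨false, ![false, false]⟩
  | .B, 3, 2 => ⟨false, ![false, true]⟩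
  | .B, 3, 3 => ⟨false, ![false, false]⟩
  | .B, 3, 4 => ⟨false, ![false, false]⟩
  | .B, 4, 0 => ⟨false, ![false, true]⟩
  | .B, 4, 1 => ⟨true, ![false, false]⟩
  | .B, 4, 2 => ⟨true, ![false, false]⟩
  | .B, 4, 3 => ⟨true, ![false, false]⟩
  | .B, 4, 4 => ⟨false, ![false, false]⟩
  | _, _, _ => ⟨false, ![false, false]⟩


set_option maxRecDepth 4000 in
/-- **The example table is a snake table** (checked by `decide`): adjacent children match, and
boundary children carry the parent's gates exactly at the middle of the crossed sides. [folklore] -/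
theorem isSnakeTable_peano : IsSnakeTable peanoChildGen peanoChildSym :=
  ⟨by decide, by decide, by decide⟩

end Example

end QuasiSelfSimilar

open QuasiSelfSimilar FunctionSpaces FunctionSpaces.Torus

/-- **Compatible block systems from two generating channels** (Alberti–Crippa–Mazzucato 2019,
§6.5, §8.1 (e), §8.6; Bruè–De Lellis 2023, §4.1). Suppose given
* two generator blocks `(V_S, Θ_S)`, `(V_B, Θ_B)` — smooth fields on `ℝ × ℝ²` satisfying the
  single-block clauses `IsGeneratorBlock` with the gates of the straight channel (the two vertical
  faces) resp. of the bent channel (the faces `{z₀ = 0}`, `{z₁ = 0}`), relative to gate fields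
  `(Vg, Θg)` and a margin `0 < δ ≤ 1/8`;
* equivariance of the gate fields under the symmetries of the square (`IsEquivariantGateField`);
* a snake table `(childGen, childSym)` — type and position of the child in each of the `25`
  subsquares of each generator — satisfying the three decidable clauses `IsSnakeTable`;
* generator-level self-similarity: on the open subsquare `p`, `Θ_g(1, z) = (σ • Θ_{g'})(0, 5z - p)`
  with `(g', σ) = (childGen g p, childSym g p)`.
Then there is a compatible block system (`acm_compatible_blocks`): the `16` blocks
`c • (V_g, Θ_g)`, `(g, c) ∈ Gen × SymmCode`, with transported gates and children
(`blockGate`, `blockChild`) and the seed of four flipped bent channels (`seedBlock`, ACM Fig. 6).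
[cite: AlbertiCrippaMazzucato2019, §6.5, §8.1 (e), §8.6] [cite: BrueDeLellisCMP2023, §4.1] -/
theorem acm_compatible_blocks_of_generators
    {V₀ : Gen → ℝ → EuclideanSpace ℝ (Fin 2) → EuclideanSpace ℝ (Fin 2)}
    {Θ₀ : Gen → ℝ → EuclideanSpace ℝ (Fin 2) → ℝ}
    {Vg : Fin 2 → ℝ → EuclideanSpace ℝ (Fin 2) → EuclideanSpace ℝ (Fin 2)}
    {Θg : Fin 2 → ℝ → EuclideanSpace ℝ (Fin 2) → ℝ} {δ : ℝ}
    {childGen : Gen → (Fin 2 → Fin 5) → Gen} {childSym : Gen → (Fin 2 → Fin 5) → SymmCode}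
    (hδ : 0 < δ) (hδ' : δ ≤ 8⁻¹)
    (hB : ∀ g, IsGeneratorBlock (V₀ g) (Θ₀ g) (genGate g) Vg Θg δ)
    (hG : IsEquivariantGateField Vg Θg)
    (hT : IsSnakeTable childGen childSym)
    (hS : ∀ (g : Gen) (p : Fin 2 → Fin 5), ∀ z ∈ latticeCellInterior 5 (fun k => ((p k : ℕ) : ℤ)),
      Θ₀ g 1 z = (childSym g p).toSymm.actScalar (Θ₀ (childGen g p)) 0
        ((5 : ℝ) • z - latticeVec (fun k => ((p k : ℕ) : ℤ)))) :
    acm_compatible_blocks := by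
  classical
  -- index the blocks `Gen × SymmCode` by `Fin N`
  set N := Fintype.card Block with hN
  let e : Fin N ≃ Block := (Fintype.equivFin Block).symm
  refine ⟨N, fun i => blockV V₀ (e i), fun i => blockΘ Θ₀ (e i),
    fun i k s => blockGate (e i) k s = true,
    fun i p => e.symm (blockChild childGen childSym (e i) p),
    fun q => e.symm (seedBlock q), Vg, Θg, δ, ?_⟩
  exact
    { δ_pos := hδ
      δ_le := hδ'
      smooth_velocity := fun i => contDiff_blockV hB (e i)
      smooth_scalar := fun i => contDiff_blockΘ hB (e i)
      divFree := fun i t ht z hz => divFree_blockV hB (e i) ht hz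
      tangent := fun i t ht z hz j hj => tangent_blockV hB (e i) ht hz j hj
      transport := fun i t ht z hz => transport_block hB (e i) ht hz
      zeroMean_zero := fun i => zeroMean_blockΘ hB (e i)
      unitL2_zero := fun i => unitL2_blockΘ hB (e i)
      abs_le := fun i t ht z hz => abs_blockΘ_le hB (e i) ht hz
      selfSimilar := fun i p z hz => by
        simp only [Equiv.apply_symm_apply]
        exact selfSimilar_block hS (e i) p hz
      vanish := fun i t z k s hz hg => vanish_block hB (e i) t z k s hz hg
      eq_gate := fun i t z k s hg hz hw => eq_gate_block hB hG (e i) t z k s hg hz hw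
      child_internal := fun i p k h => by
        simp only [Equiv.apply_symm_apply]
        exact blockChild_internal hT (e i) p k h
      child_boundary_hi := fun i p k hp => by
        simp only [Equiv.apply_symm_apply]
        exact blockChild_boundary_hi hT (e i) p k hp
      child_boundary_lo := fun i p k hp => by
        simp only [Equiv.apply_symm_apply]
        exact blockChild_boundary_lo hT (e i) p k hp
      seed_internal := fun q k h => by
        simp only [Equiv.apply_symm_apply]
        exact seedBlock_internal q k h
      seed_boundary_hi := fun q k h => by
        simp only [Equiv.apply_symm_apply]
        exact seedBlock_boundary_hi q k h
      seed_boundary_lo := fun q k h => by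
        simp only [Equiv.apply_symm_apply]
        exact seedBlock_boundary_lo q k h }

end Literature.Analysis.FluidPDE

end
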